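import Mathlib
import HarnessLib

/-!
# Jacobi's method for the symmetric eigenvalue problem (Süli–Mayers §5.3)

Source typed verbatim: E. Süli and D. F. Mayers, *An Introduction to Numerical Analysis*
(Cambridge University Press, 2003), §5.3 "Jacobi's method", pp. 137–144
[cite: SuliMayers2003, §5.3].

* Definition 5.2: the plane rotation matrix `R^{(pq)}(φ) ∈ ℝ^{n×n}` — the identity except
  for `r_pp = c`, `r_pq = s`, `r_qp = -s`, `r_qq = c`, `c = cos φ`, `s = sin φ`
  (`jacobiRot p q c s`, `rotation p q φ`); it is orthogonal (`jacobiRot_transpose_mul_self`,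
  `rotation_transpose_mul_self`).
* Theorem 5.2 and its proof: the column formulas (5.3) for `A' = AR`, the row formulas (5.4) for
  `B = Rᵀ A'`, the entries (5.5) of `B = Rᵀ A R` (`b_pp`, `b_qq`, `b_pq = b_qp`, `b_ip`, `b_iq`,
  `b_ij = a_ij` off rows/columns `p, q`), the angle conditions (5.6)–(5.7)
  (`(a_qq - a_pp) sin 2φ = 2 a_pq cos 2φ`) and (5.8) (`(a_pp - a_qq) t + a_pq (1 - t²) = 0`,
  `t = s / c = tan φ`), and the conclusion: for symmetric `A` and `p ≠ q` there is
  `φ ∈ [-π/4, π/4]` with `(R^{(pq)}(φ)ᵀ A R^{(pq)}(φ))_pq = 0`; the footnote to (5.7)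
  (`b_pp - a_pp = -a_pq tan φ`, `b_qq - a_qq = a_pq tan φ`).
* Lemma 5.1 with (5.9)–(5.11): `Trace(A²) = Σ a_ij²` for symmetric `A`, and the sum of squares
  of the entries (the squared Frobenius norm) is invariant under `A ↦ Rᵀ A R`, `R` orthogonal.
* Definition 5.3 (one step of the classical Jacobi method: annihilate the off-diagonal entry of
  largest absolute value, `IsJacobiStep`) and Theorem 5.3 with its proof: `S = D + L`,
  `D(B) = D(A) + 2 a_pq²`, `L(B) = L(A) - 2 a_pq²`, `L(A) ≤ N a_pq²` and (5.14)
  `L(B) ≤ (1 - 2/N) L(A)` with `N = n(n-1)` the number of off-diagonal elements, (5.15)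
  `0 ≤ L(A^{(k)}) ≤ (1 - 2/N)^k L(A)`, (5.12) `L(A^{(k)}) → 0` (so every off-diagonal entry
  tends to `0`), (5.13) `D(A^{(k)}) → Trace(A²)`; Example 5.3 / Table 5.1, row `k = 0`
  (`D = 43`, `L = 88`, `Trace(A²) = 131` for the matrix (5.16)); and the closing remarks of §5.3:
  the accumulated product of rotations is orthogonal, and `Mᵀ A M = D` diagonal with `M`
  orthogonal makes the columns of `M` eigenvectors of `A`.

Rendering. Indices range over a `Fintype` `n` (the book has `{1,…,n}`, `p < q`; only `p ≠ q`
matters). `c, s` are kept as free real parameters with the constraint `c² + s² = 1` where it is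
needed, `rotation p q φ` specialises to `c = cos φ`, `s = sin φ`. The "largest off-diagonal
element" is any `(p, q)`, `p ≠ q`, maximising `|a_ij|` over `i ≠ j`. The identification
`Trace(A²) = Σ λ_i²` (Theorem 5.1 (viii)) quoted at the end of the proof of Theorem 5.3 is not
re-typed here (Mathlib's `Matrix.IsHermitian.trace_eq_sum_eigenvalues` is the relevant fact).

Nearest existing declarations (named, not restated, not imported):
`Literature.Algebra.EuclideanLattices.ARVerifierAlgebra.trace_transpose_mul_self_eq`
(`trace (Mᵀ M) = Σ M_ij²` for rectangular `M`; re-derived below only as a private helper, the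
public statement being the symmetric form (5.10) `Trace(A²) = Σ a_ij²`),
`Literature.Analysis.Convex.GaussNewtonMethod.sumSq` (residual sum of squares of a vector — a
namesake of `sumSq` below, different object),
`Literature.Geometry.DiscreteGeometry.SphericalWedgeVolume.planeRot` (a rotation of an inner
product space in the plane of two orthonormal vectors — a different object with a similar name),
`Literature.AlgebraicTopology.FundamentalGroup.RotationGroupSO3` (coordinate-axis rotations of
`ℝ³`, Givens elimination in `SO(3)`), Mathlib's `Matrix.IsSymm`, `Matrix.trace_mul_cycle`,
`mul_eq_one_comm`, `Real.arctan` (used).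
-/

noncomputable section

open Finset Filter

open scoped Topology Matrix

namespace Literature.Analysis.Matrix.JacobiRotationMethod

variable {n : Type*} [Fintype n] [DecidableEq n]
variable {A B : Matrix n n ℝ} {p q i j : n} {c s : ℝ}

/-! ## Definition 5.2: plane rotations -/

/-- Definition 5.2 [cite: SuliMayers2003, §5.3 Def 5.2]: the plane rotation matrix with entries
`c, s`: equal to the identity matrix except for `r_pp = c`, `r_pq = s`, `r_qp = -s`, `r_qq = c`. -/
def jacobiRot (p q : n) (c s : ℝ) : Matrix n n ℝ := fun i j =>
  if j = p then (if i = p then c else if i = q then -s else 0)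
  else if j = q then (if i = p then s else if i = q then c else 0)
  else if i = j then 1 else 0

/-- Definition 5.2 [cite: SuliMayers2003, §5.3 Def 5.2]: `R^{(pq)}(φ)`, the plane rotation matrix
with `c = cos φ`, `s = sin φ`. -/
def rotation (p q : n) (φ : ℝ) : Matrix n n ℝ := jacobiRot p q (Real.cos φ) (Real.sin φ)

/-- The transformed matrix `B = Rᵀ A R` of Theorem 5.2 / Definition 5.3
[cite: SuliMayers2003, §5.3 Thm 5.2]. -/
def rotConj (A : Matrix n n ℝ) (p q : n) (c s : ℝ) : Matrix n n ℝ :=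
  (jacobiRot p q c s)ᵀ * A * jacobiRot p q c s

omit [Fintype n] in
/-- The four special entries of the plane rotation matrix: `r_pp = c`, `r_pq = s`, `r_qp = -s`,
`r_qq = c` [cite: SuliMayers2003, §5.3 Def 5.2]. -/
theorem jacobiRot_apply_special (hpq : p ≠ q) (c s : ℝ) :
    jacobiRot p q c s p p = c ∧ jacobiRot p q c s p q = s ∧ jacobiRot p q c s q p = -s ∧
      jacobiRot p q c s q q = c := by
  refine ⟨?_, ?_, ?_, ?_⟩ <;> simp [jacobiRot, hpq.symm]

omit [Fintype n] in
/-- Row `p` of the plane rotation matrix [cite: SuliMayers2003, §5.3 Def 5.2]. -/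
theorem jacobiRot_row_p (hpq : p ≠ q) (c s : ℝ) (j : n) :
    jacobiRot p q c s p j = if j = p then c else if j = q then s else 0 := by
  by_cases hjp : j = p
  · simp [jacobiRot, hjp]
  · by_cases hjq : j = q
    · simp [jacobiRot, hjq, hpq.symm]
    · simp [jacobiRot, hjp, hjq, Ne.symm hjp]

omit [Fintype n] in
/-- Row `q` of the plane rotation matrix [cite: SuliMayers2003, §5.3 Def 5.2]. -/
theorem jacobiRot_row_q (hpq : p ≠ q) (c s : ℝ) (j : n) :
    jacobiRot p q c s q j = if j = p then -s else if j = q then c else 0 := by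
  by_cases hjp : j = p
  · simp [jacobiRot, hjp, hpq.symm]
  · by_cases hjq : j = q
    · simp [jacobiRot, hjq, hpq.symm]
    · simp [jacobiRot, hjp, hjq, Ne.symm hjq]

omit [Fintype n] in
/-- Away from rows `p, q` the plane rotation matrix agrees with the identity matrix
[cite: SuliMayers2003, §5.3 Def 5.2]. -/
theorem jacobiRot_row_of_ne (hi : i ≠ p) (hi' : i ≠ q) (c s : ℝ) (j : n) :
    jacobiRot p q c s i j = if i = j then 1 else 0 := by
  by_cases hjp : j = p
  · simp [jacobiRot, hjp, hi, hi']
  · by_cases hjq : j = q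
    · simp [jacobiRot, hjq, hi, hi']
    · simp [jacobiRot, hjp, hjq]

/-- Summing against column `p` or `q` of the rotation picks out two terms. [folklore] -/
private theorem sum_mul_two (f : n → ℝ) (hpq : p ≠ q) (x y : ℝ) :
    ∑ l, f l * (if l = p then x else if l = q then y else 0) = f p * x + f q * y := by
  rw [Finset.sum_eq_add p q hpq]
  · simp [hpq.symm]
  · intro l _ hl
    simp [hl.1, hl.2]
  · simp
  · simp

/-! ## Theorem 5.2: the entries of `AR`, `RᵀA'` and `B = RᵀAR` -/

/-- (5.3) [cite: SuliMayers2003, §5.3 Thm 5.2 (5.3)]: `A' = AR` differs from `A` only in columns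
`p` and `q`: `a'_ip = a_ip c - a_iq s`, `a'_iq = a_ip s + a_iq c`, `a'_ij = a_ij` otherwise. -/
theorem mul_jacobiRot_apply (A : Matrix n n ℝ) (hpq : p ≠ q) (c s : ℝ) (i j : n) :
    (A * jacobiRot p q c s) i j =
      if j = p then A i p * c - A i q * s else if j = q then A i p * s + A i q * c else A i j := by
  by_cases hjp : j = p
  · have hcol : ∀ l, jacobiRot p q c s l j = if l = p then c else if l = q then -s else 0 := by
      intro l
      simp only [jacobiRot, if_pos hjp]
    rw [Matrix.mul_apply, if_pos hjp]
    simp_rw [hcol]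
    rw [sum_mul_two _ hpq]
    ring
  · by_cases hjq : j = q
    · have hcol : ∀ l, jacobiRot p q c s l j = if l = p then s else if l = q then c else 0 := by
        intro l
        simp only [jacobiRot, if_neg hjp, if_pos hjq]
      rw [Matrix.mul_apply, if_neg hjp, if_pos hjq]
      simp_rw [hcol]
      rw [sum_mul_two _ hpq]
    · have hcol : ∀ l, jacobiRot p q c s l j = if l = j then 1 else 0 := by
        intro l
        simp only [jacobiRot, if_neg hjp, if_neg hjq]
      rw [Matrix.mul_apply, if_neg hjp, if_neg hjq]
      simp_rw [hcol]
      simp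

/-- (5.4) [cite: SuliMayers2003, §5.3 Thm 5.2 (5.4)]: multiplication by `Rᵀ` on the left affects
rows `p` and `q`: `b_pj = a'_pj c - a'_qj s`, `b_qj = a'_pj s + a'_qj c`, other rows unchanged. -/
theorem jacobiRot_transpose_mul_apply (A : Matrix n n ℝ) (hpq : p ≠ q) (c s : ℝ) (i j : n) :
    ((jacobiRot p q c s)ᵀ * A) i j =
      if i = p then c * A p j - s * A q j else if i = q then s * A p j + c * A q j else A i j := by
  rw [show (jacobiRot p q c s)ᵀ * A = (Aᵀ * jacobiRot p q c s)ᵀ by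
      rw [Matrix.transpose_mul, Matrix.transpose_transpose],
    Matrix.transpose_apply, mul_jacobiRot_apply _ hpq]
  simp only [Matrix.transpose_apply]
  split_ifs <;> ring

/-- The entries of `B = RᵀAR` from (5.4) applied to `A' = AR`. [folklore] -/
private theorem rotConj_apply (A : Matrix n n ℝ) (hpq : p ≠ q) (c s : ℝ) (i j : n) :
    rotConj A p q c s i j =
      if i = p then c * (A * jacobiRot p q c s) p j - s * (A * jacobiRot p q c s) q j
      else if i = q then s * (A * jacobiRot p q c s) p j + c * (A * jacobiRot p q c s) q j
      else (A * jacobiRot p q c s) i j := by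
  unfold rotConj
  rw [Matrix.mul_assoc, jacobiRot_transpose_mul_apply _ hpq]

/-- (5.5) [cite: SuliMayers2003, §5.3 Thm 5.2 (5.5)]: `b_pp = a_pp c² - 2 a_pq s c + a_qq s²`
(for symmetric `A`). -/
theorem rotConj_apply_pp (hA : A.IsSymm) (hpq : p ≠ q) (c s : ℝ) :
    rotConj A p q c s p p = A p p * c ^ 2 - 2 * A p q * s * c + A q q * s ^ 2 := by
  have h := hA.apply p q
  simp [rotConj_apply A hpq, mul_jacobiRot_apply A hpq] at h ⊢
  rw [h]
  ring

/-- (5.5) [cite: SuliMayers2003, §5.3 Thm 5.2 (5.5)]: `b_qq = a_pp s² + 2 a_pq s c + a_qq c²`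
(for symmetric `A`). -/
theorem rotConj_apply_qq (hA : A.IsSymm) (hpq : p ≠ q) (c s : ℝ) :
    rotConj A p q c s q q = A p p * s ^ 2 + 2 * A p q * s * c + A q q * c ^ 2 := by
  have h := hA.apply p q
  simp [rotConj_apply A hpq, mul_jacobiRot_apply A hpq, hpq.symm] at h ⊢
  rw [h]
  ring

/-- (5.5) [cite: SuliMayers2003, §5.3 Thm 5.2 (5.5)]: `b_pq = (a_pp - a_qq) s c + a_pq (c² - s²)`
(for symmetric `A`). -/
theorem rotConj_apply_pq (hA : A.IsSymm) (hpq : p ≠ q) (c s : ℝ) :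
    rotConj A p q c s p q = (A p p - A q q) * s * c + A p q * (c ^ 2 - s ^ 2) := by
  have h := hA.apply p q
  simp [rotConj_apply A hpq, mul_jacobiRot_apply A hpq, hpq.symm] at h ⊢
  rw [h]
  ring

/-- (5.5) [cite: SuliMayers2003, §5.3 Thm 5.2 (5.5)]: `b_qp = b_pq` (for symmetric `A`). -/
theorem rotConj_apply_qp (hA : A.IsSymm) (hpq : p ≠ q) (c s : ℝ) :
    rotConj A p q c s q p = (A p p - A q q) * s * c + A p q * (c ^ 2 - s ^ 2) := by
  have h := hA.apply p q
  simp [rotConj_apply A hpq, mul_jacobiRot_apply A hpq, hpq.symm] at h ⊢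
  rw [h]
  ring

/-- (5.5), remaining entries of column `p` [cite: SuliMayers2003, §5.3 Thm 5.2 (5.5)]:
`b_ip = a_ip c - a_iq s` for `i ≠ p, q`. -/
theorem rotConj_apply_ip (hpq : p ≠ q) (hi : i ≠ p) (hi' : i ≠ q) (c s : ℝ) :
    rotConj A p q c s i p = A i p * c - A i q * s := by
  simp [rotConj_apply A hpq, mul_jacobiRot_apply A hpq, hi, hi']

/-- (5.5), remaining entries of column `q` [cite: SuliMayers2003, §5.3 Thm 5.2 (5.5)]:
`b_iq = a_ip s + a_iq c` for `i ≠ p, q`. -/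
theorem rotConj_apply_iq (hpq : p ≠ q) (hi : i ≠ p) (hi' : i ≠ q) (c s : ℝ) :
    rotConj A p q c s i q = A i p * s + A i q * c := by
  simp [rotConj_apply A hpq, mul_jacobiRot_apply A hpq, hpq.symm, hi, hi']

/-- The nondiagonal elements of `B` in rows `p` and `q` [cite: SuliMayers2003, §5.3 Thm 5.2 (5.5)]:
`b_pj = c a_pj - s a_qj`, `b_qj = s a_pj + c a_qj` for `j ≠ p, q` (for symmetric `A` these are the
same expressions as `b_jp`, `b_jq`). -/
theorem rotConj_apply_pj_qj (hpq : p ≠ q) (hj : j ≠ p) (hj' : j ≠ q) (c s : ℝ) :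
    rotConj A p q c s p j = c * A p j - s * A q j ∧
      rotConj A p q c s q j = s * A p j + c * A q j := by
  constructor <;> simp [rotConj_apply A hpq, mul_jacobiRot_apply A hpq, hpq.symm, hj, hj']

/-- [cite: SuliMayers2003, §5.3 Thm 5.2 (5.5)]: all the elements of `B = RᵀAR` which lie neither
in row `p` or `q` nor in column `p` or `q` are the same as those of `A`: `b_ij = a_ij`. -/
theorem rotConj_apply_of_ne (hpq : p ≠ q) (hi : i ≠ p) (hi' : i ≠ q) (hj : j ≠ p)
    (hj' : j ≠ q) (c s : ℝ) : rotConj A p q c s i j = A i j := by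
  simp [rotConj_apply A hpq, mul_jacobiRot_apply A hpq, hi, hi', hj, hj']

/-- [cite: SuliMayers2003, §5.3 Thm 5.2]: "the matrix `B = RᵀAR` is evidently symmetric". -/
theorem isSymm_rotConj (hA : A.IsSymm) (p q : n) (c s : ℝ) : (rotConj A p q c s).IsSymm := by
  unfold rotConj Matrix.IsSymm
  rw [Matrix.transpose_mul, Matrix.transpose_mul, Matrix.transpose_transpose, hA.eq,
    Matrix.mul_assoc]

/-! ## Definition 5.2 continued: orthogonality -/

/-- [cite: SuliMayers2003, §5.3 Def 5.2]: `(R^{(pq)})ᵀ R^{(pq)} = I` — the plane rotation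
matrix is orthogonal (`c² + s² = 1`). -/
theorem jacobiRot_transpose_mul_self (hpq : p ≠ q) (hcs : c ^ 2 + s ^ 2 = 1) :
    (jacobiRot p q c s)ᵀ * jacobiRot p q c s = 1 := by
  ext i j
  rw [jacobiRot_transpose_mul_apply _ hpq, jacobiRot_row_p hpq, jacobiRot_row_q hpq,
    Matrix.one_apply]
  split_ifs <;> first
    | linear_combination hcs
    | ring1
    | simp_all [jacobiRot]

/-- [cite: SuliMayers2003, §5.3 Def 5.2]: `R^{(pq)} (R^{(pq)})ᵀ = I`. -/
theorem jacobiRot_mul_transpose_self (hpq : p ≠ q) (hcs : c ^ 2 + s ^ 2 = 1) :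
    jacobiRot p q c s * (jacobiRot p q c s)ᵀ = 1 :=
  mul_eq_one_comm.1 (jacobiRot_transpose_mul_self hpq hcs)

/-- [cite: SuliMayers2003, §5.3 Def 5.2]:
`R^{(pq)}(φ) (R^{(pq)}(φ))ᵀ = (R^{(pq)}(φ))ᵀ R^{(pq)}(φ) = I`; hence `R^{(pq)}(φ)` is an
orthogonal matrix for any `p ≠ q` and any `φ`. -/
theorem rotation_transpose_mul_self (hpq : p ≠ q) (φ : ℝ) :
    (rotation p q φ)ᵀ * rotation p q φ = 1 ∧ rotation p q φ * (rotation p q φ)ᵀ = 1 :=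
  ⟨jacobiRot_transpose_mul_self hpq (Real.cos_sq_add_sin_sq φ),
    jacobiRot_mul_transpose_self hpq (Real.cos_sq_add_sin_sq φ)⟩

/-! ## Theorem 5.2: the choice of the angle -/

/-- (5.6)–(5.7) [cite: SuliMayers2003, §5.3 Thm 5.2 (5.6)–(5.7)]: by (5.5) and the identities
`c² - s² = cos 2φ`, `sc = ½ sin 2φ`, the `(p,q)` entry of `R^{(pq)}(φ)ᵀ A R^{(pq)}(φ)`
vanishes exactly when `(a_qq - a_pp) sin 2φ = 2 a_pq cos 2φ`
(i.e. `tan 2φ = 2a_pq/(a_qq - a_pp)`). -/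
theorem rotation_conj_pq_eq_zero_iff (hA : A.IsSymm) (hpq : p ≠ q) (φ : ℝ) :
    ((rotation p q φ)ᵀ * A * rotation p q φ) p q = 0 ↔
      (A q q - A p p) * Real.sin (2 * φ) = 2 * A p q * Real.cos (2 * φ) := by
  show rotConj A p q (Real.cos φ) (Real.sin φ) p q = 0 ↔ _
  rw [rotConj_apply_pq hA hpq, Real.sin_two_mul, Real.cos_two_mul]
  have h1 := Real.cos_sq_add_sin_sq φ
  constructor
  · intro h
    linear_combination (-2) * h - 2 * A p q * h1
  · intro h
    linear_combination (-1 / 2) * h - A p q * h1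

/-- (5.8) [cite: SuliMayers2003, §5.3 Thm 5.2 (5.8)]: writing `t = s/c`, the `(p,q)` entry of
`B = RᵀAR` vanishes iff `(a_pp - a_qq) t + a_pq (1 - t²) = 0`. -/
theorem rotConj_pq_eq_zero_iff (hA : A.IsSymm) (hpq : p ≠ q) (hc : c ≠ 0) (s : ℝ) :
    rotConj A p q c s p q = 0 ↔ (A p p - A q q) * (s / c) + A p q * (1 - (s / c) ^ 2) = 0 := by
  have key : (A p p - A q q) * s * c + A p q * (c ^ 2 - s ^ 2) =
      c ^ 2 * ((A p p - A q q) * (s / c) + A p q * (1 - (s / c) ^ 2)) := by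
    field_simp
  rw [rotConj_apply_pq hA hpq, key, mul_eq_zero, or_iff_right (pow_ne_zero 2 hc)]

/-- (5.8) is always solvable with `|t| ≤ 1` [cite: SuliMayers2003, §5.3 Thm 5.2 (5.8)]: the
equation `d t + a (1 - t²) = 0` has a root `t ∈ [-1, 1]` (the book: `t = 0` if `a = 0`,
`t = 1` if `a ≠ 0`, `d = 0`, else the root of the quadratic that is smaller in absolute value;
here: the two values at `t = ∓1` are `∓d`, so the intermediate value theorem applies). -/
theorem exists_root_Icc (d a : ℝ) :
    ∃ t ∈ Set.Icc (-1 : ℝ) 1, d * t + a * (1 - t ^ 2) = 0 := by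
  have hcont : ContinuousOn (fun t : ℝ => d * t + a * (1 - t ^ 2)) (Set.Icc (-1) 1) := by
    fun_prop
  rcases le_total 0 d with hd | hd
  · have h0 : (0 : ℝ) ∈ Set.Icc ((fun t : ℝ => d * t + a * (1 - t ^ 2)) (-1))
        ((fun t : ℝ => d * t + a * (1 - t ^ 2)) 1) := by
      simp only [Set.mem_Icc]
      constructor <;> nlinarith
    exact intermediate_value_Icc (by norm_num) hcont h0
  · have h0 : (0 : ℝ) ∈ Set.Icc ((fun t : ℝ => d * t + a * (1 - t ^ 2)) 1)
        ((fun t : ℝ => d * t + a * (1 - t ^ 2)) (-1)) := by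
      simp only [Set.mem_Icc]
      constructor <;> nlinarith
    exact intermediate_value_Icc' (by norm_num) hcont h0

/-- Theorem 5.2, `(c, s)` form [cite: SuliMayers2003, §5.3 Thm 5.2]: for symmetric `A` and
`p ≠ q` there are `c = 1/(1+t²)^{1/2} > 0` and `s = ct` with `|t| ≤ 1` (so `c² + s² = 1`,
`|s| ≤ c`, i.e. `|φ| ≤ π/4`) such that the `(p,q)` entry of `RᵀAR` is `0`. -/
theorem exists_cs_rotConj_pq_eq_zero (hA : A.IsSymm) (hpq : p ≠ q) :
    ∃ c s : ℝ, c ^ 2 + s ^ 2 = 1 ∧ 0 < c ∧ |s| ≤ c ∧ rotConj A p q c s p q = 0 := by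
  obtain ⟨t, ht, hroot⟩ := exists_root_Icc (A p p - A q q) (A p q)
  have h1 : 0 < 1 + t ^ 2 := by positivity
  obtain ⟨c, hc_def⟩ : ∃ c : ℝ, c = 1 / Real.sqrt (1 + t ^ 2) := ⟨_, rfl⟩
  have hc : 0 < c := by
    rw [hc_def]
    positivity
  have hc2 : c ^ 2 * (1 + t ^ 2) = 1 := by
    rw [hc_def, div_pow, one_pow, Real.sq_sqrt h1.le]
    field_simp
  refine ⟨c, t * c, ?_, hc, ?_, ?_⟩
  · linear_combination hc2
  · rw [abs_mul, abs_of_pos hc]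
    exact mul_le_of_le_one_left hc.le (abs_le.mpr ⟨ht.1, ht.2⟩)
  · rw [rotConj_pq_eq_zero_iff hA hpq hc.ne', mul_div_cancel_right₀ t hc.ne']
    exact hroot

/-- **Theorem 5.2** [cite: SuliMayers2003, §5.3 Thm 5.2]: suppose `A ∈ ℝ^{n×n}_sym`. For each
pair `p ≠ q` there exists `φ ∈ [-π/4, π/4]` such that the `(p,q)` entry of the symmetric
matrix `R^{(pq)}(φ)ᵀ A R^{(pq)}(φ)` is equal to `0`. -/
theorem exists_rotation_conj_pq_eq_zero (hA : A.IsSymm) (hpq : p ≠ q) :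
    ∃ φ ∈ Set.Icc (-(Real.pi / 4)) (Real.pi / 4),
      ((rotation p q φ)ᵀ * A * rotation p q φ) p q = 0 := by
  obtain ⟨t, ht, hroot⟩ := exists_root_Icc (A p p - A q q) (A p q)
  refine ⟨Real.arctan t, ⟨?_, ?_⟩, ?_⟩
  · have h := Real.arctan_mono ht.1
    rw [Real.arctan_neg, Real.arctan_one] at h
    exact h
  · have h := Real.arctan_mono ht.2
    rw [Real.arctan_one] at h
    exact h
  · have hc : Real.cos (Real.arctan t) ≠ 0 := (Real.cos_arctan_pos t).ne'
    show rotConj A p q (Real.cos (Real.arctan t)) (Real.sin (Real.arctan t)) p q = 0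
    rw [rotConj_pq_eq_zero_iff hA hpq hc, ← Real.tan_eq_sin_div_cos, Real.tan_arctan]
    exact hroot

/-- The footnote to (5.7) [cite: SuliMayers2003, §5.3 Thm 5.2 footnote 1]: when `b_pq = 0`,
`b_pp - a_pp = -a_pq tan φ` and `b_qq - a_qq = a_pq tan φ` (`tan φ = s/c`), while `b_ii = a_ii`
for `i ≠ p, q`. -/
theorem rotConj_diag_sub (hA : A.IsSymm) (hpq : p ≠ q) (hcs : c ^ 2 + s ^ 2 = 1) (hc : c ≠ 0)
    (h0 : rotConj A p q c s p q = 0) :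
    rotConj A p q c s p p - A p p = -A p q * (s / c) ∧
      rotConj A p q c s q q - A q q = A p q * (s / c) ∧
      ∀ i, i ≠ p → i ≠ q → rotConj A p q c s i i - A i i = 0 := by
  rw [rotConj_apply_pq hA hpq] at h0
  refine ⟨?_, ?_, fun i hi hi' => by rw [rotConj_apply_of_ne hpq hi hi' hi hi', sub_self]⟩
  · have key : c * (rotConj A p q c s p p - A p p) = -A p q * s := by
      rw [rotConj_apply_pp hA hpq]
      linear_combination (A p p * c - A p q * s) * hcs - s * h0
    rw [← mul_div_assoc, eq_div_iff hc]
    linear_combination key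
  · have key : c * (rotConj A p q c s q q - A q q) = A p q * s := by
      rw [rotConj_apply_qq hA hpq]
      linear_combination (A q q * c + A p q * s) * hcs + s * h0
    rw [← mul_div_assoc, eq_div_iff hc]
    linear_combination key

/-! ## Lemma 5.1: the sum of squares of the entries -/

/-- `S(A) = Σ_i Σ_j a_ij²`, the sum of squares of the elements of `A` (the square of the
Frobenius norm `‖A‖_F`) [cite: SuliMayers2003, §5.3 Lemma 5.1]. -/
def sumSq (A : Matrix n n ℝ) : ℝ := ∑ i, ∑ j, A i j ^ 2

/-- `D(A) = Σ_i a_ii²` [cite: SuliMayers2003, §5.3 Thm 5.3]. -/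
def diagSq (A : Matrix n n ℝ) : ℝ := ∑ i, A i i ^ 2

/-- `L(A) = Σ_{i ≠ j} a_ij²` [cite: SuliMayers2003, §5.3 Thm 5.3]. -/
def offSq (A : Matrix n n ℝ) : ℝ := ∑ i, ∑ j, if i = j then 0 else A i j ^ 2

/-- `N = n(n-1)`, the number of off-diagonal elements [cite: SuliMayers2003, §5.3 Thm 5.3]. -/
def offCount (n : Type*) [Fintype n] : ℝ := (Fintype.card n : ℝ) * (Fintype.card n - 1)

omit [DecidableEq n] in
/-- The trace of `MᵀM` is the sum of squares of the elements of `M` (cf. the rectangular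
`Literature.Algebra.EuclideanLattices.ARVerifierAlgebra.trace_transpose_mul_self_eq`, not imported).
[folklore] -/
private theorem trace_transpose_mul (M : Matrix n n ℝ) :
    Matrix.trace (Mᵀ * M) = sumSq M := by
  unfold sumSq Matrix.trace
  simp only [Matrix.diag_apply, Matrix.mul_apply, Matrix.transpose_apply, pow_two]
  exact Finset.sum_comm

omit [DecidableEq n] in
/-- (5.10) [cite: SuliMayers2003, §5.3 Lemma 5.1 (5.10)]: for symmetric `A`,
`Trace(A²) = Σ_i (A²)_ii = Σ_i Σ_j a_ij a_ji = Σ_i Σ_j a_ij²`. -/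
theorem trace_mul_self_of_isSymm (hA : A.IsSymm) : Matrix.trace (A * A) = sumSq A := by
  rw [← trace_transpose_mul, hA.eq]

/-- **Lemma 5.1** [cite: SuliMayers2003, §5.3 Lemma 5.1 (5.9)]: the sum of squares of the elements
of a matrix is invariant under an orthogonal transformation: if `B = RᵀAR` with `R` orthogonal
then `Σ_i Σ_j b_ij² = Σ_i Σ_j a_ij²`, i.e. `‖RᵀAR‖_F = ‖A‖_F` (symmetry of `A` is
not needed). -/
theorem sumSq_orthogonal_conj (A R : Matrix n n ℝ) (hR : Rᵀ * R = 1) :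
    sumSq (Rᵀ * A * R) = sumSq A := by
  have hR' : R * Rᵀ = 1 := mul_eq_one_comm.1 hR
  have h1 : (Rᵀ * A * R)ᵀ * (Rᵀ * A * R) = Rᵀ * (Aᵀ * A) * R := by
    rw [Matrix.transpose_mul, Matrix.transpose_mul, Matrix.transpose_transpose]
    calc Rᵀ * (Aᵀ * R) * (Rᵀ * A * R) = Rᵀ * Aᵀ * (R * Rᵀ) * A * R := by
          simp only [Matrix.mul_assoc]
      _ = Rᵀ * (Aᵀ * A) * R := by rw [hR', Matrix.mul_one, Matrix.mul_assoc Rᵀ Aᵀ A]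
  rw [← trace_transpose_mul, ← trace_transpose_mul, h1, Matrix.trace_mul_cycle, hR',
    Matrix.one_mul]

/-- (5.11) [cite: SuliMayers2003, §5.3 Lemma 5.1 (5.11)]: `B² = (RᵀAR)(RᵀAR) = RᵀA²R` since
`R` is orthogonal. -/
theorem orthogonal_conj_mul_self (A R : Matrix n n ℝ) (hR : R * Rᵀ = 1) :
    Rᵀ * A * R * (Rᵀ * A * R) = Rᵀ * (A * A) * R := by
  calc Rᵀ * A * R * (Rᵀ * A * R) = Rᵀ * A * (R * Rᵀ) * A * R := by
        simp only [Matrix.mul_assoc]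
    _ = Rᵀ * (A * A) * R := by rw [hR, Matrix.mul_one, Matrix.mul_assoc Rᵀ A A]

/-- Lemma 5.1 for a Jacobi rotation [cite: SuliMayers2003, §5.3 Lemma 5.1 (5.9)]:
`S(RᵀAR) = S(A)` for `R = R^{(pq)}`, `c² + s² = 1`. -/
theorem sumSq_rotConj (A : Matrix n n ℝ) (hpq : p ≠ q) (hcs : c ^ 2 + s ^ 2 = 1) :
    sumSq (rotConj A p q c s) = sumSq A :=
  sumSq_orthogonal_conj A _ (jacobiRot_transpose_mul_self hpq hcs)

/-! ## Theorem 5.3: `S = D + L` and the effect of one rotation -/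

/-- [cite: SuliMayers2003, §5.3 Thm 5.3]: `S(A) = D(A) + L(A)`. -/
theorem sumSq_eq_diagSq_add_offSq (A : Matrix n n ℝ) : sumSq A = diagSq A + offSq A := by
  have hdiag : ∀ i, A i i ^ 2 = ∑ j, if i = j then A i j ^ 2 else 0 := by
    intro i
    rw [Finset.sum_ite_eq]
    simp
  unfold sumSq diagSq offSq
  rw [← Finset.sum_add_distrib]
  refine Finset.sum_congr rfl fun i _ => ?_
  rw [hdiag i, ← Finset.sum_add_distrib]
  refine Finset.sum_congr rfl fun j _ => ?_
  split_ifs <;> simp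

/-- `L(A) ≥ 0` [cite: SuliMayers2003, §5.3 Thm 5.3 (5.15)]. -/
theorem offSq_nonneg (A : Matrix n n ℝ) : 0 ≤ offSq A :=
  Finset.sum_nonneg fun i _ => Finset.sum_nonneg fun j _ => by
    split_ifs
    · exact le_rfl
    · exact sq_nonneg _

/-- A single off-diagonal square is at most `L(A)` [cite: SuliMayers2003, §5.3 Thm 5.3 (5.12)]. -/
theorem sq_le_offSq (A : Matrix n n ℝ) (hij : i ≠ j) : A i j ^ 2 ≤ offSq A := by
  unfold offSq
  calc A i j ^ 2 = (if i = j then 0 else A i j ^ 2) := by rw [if_neg hij]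
    _ ≤ ∑ j', (if i = j' then 0 else A i j' ^ 2) :=
        Finset.single_le_sum (f := fun j' => if i = j' then 0 else A i j' ^ 2)
          (fun j' _ => by
            split_ifs
            · exact le_rfl
            · exact sq_nonneg _) (Finset.mem_univ j)
    _ ≤ ∑ i', ∑ j', (if i' = j' then 0 else A i' j' ^ 2) :=
        Finset.single_le_sum (f := fun i' => ∑ j', (if i' = j' then 0 else A i' j' ^ 2))
          (fun i' _ => Finset.sum_nonneg fun j' _ => by
            split_ifs
            · exact le_rfl
            · exact sq_nonneg _) (Finset.mem_univ i)

/-- The `2 × 2` identity behind Theorem 5.3 [cite: SuliMayers2003, §5.3 Thm 5.3]: by Lemma 5.1 for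
the `(p,q)` block, `b_pp² + 2 b_pq² + b_qq² = a_pp² + 2 a_pq² + a_qq²`. -/
theorem rotConj_block_sumSq (hA : A.IsSymm) (hpq : p ≠ q) (hcs : c ^ 2 + s ^ 2 = 1) :
    rotConj A p q c s p p ^ 2 + 2 * rotConj A p q c s p q ^ 2 + rotConj A p q c s q q ^ 2 =
      A p p ^ 2 + 2 * A p q ^ 2 + A q q ^ 2 := by
  rw [rotConj_apply_pp hA hpq, rotConj_apply_pq hA hpq, rotConj_apply_qq hA hpq]
  linear_combination (A p p ^ 2 + 2 * A p q ^ 2 + A q q ^ 2) * (c ^ 2 + s ^ 2 + 1) * hcs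

/-- [cite: SuliMayers2003, §5.3 Thm 5.3]: if `b_pq = 0` then `D(B) = D(A) + 2 a_pq²` (the diagonal
entries of `B` are those of `A` except in rows `p, q`, and
`b_pp² + b_qq² = a_pp² + a_qq² + 2a_pq²`). -/
theorem diagSq_rotConj (hA : A.IsSymm) (hpq : p ≠ q) (hcs : c ^ 2 + s ^ 2 = 1)
    (h0 : rotConj A p q c s p q = 0) :
    diagSq (rotConj A p q c s) = diagSq A + 2 * A p q ^ 2 := by
  have hblock := rotConj_block_sumSq hA hpq hcs
  rw [h0] at hblock
  have hsum : ∑ i, (rotConj A p q c s i i ^ 2 - A i i ^ 2) =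
      (rotConj A p q c s p p ^ 2 - A p p ^ 2) + (rotConj A p q c s q q ^ 2 - A q q ^ 2) := by
    apply Finset.sum_eq_add p q hpq
    · intro i _ hi
      rw [rotConj_apply_of_ne hpq hi.1 hi.2 hi.1 hi.2, sub_self]
    · simp
    · simp
  rw [Finset.sum_sub_distrib] at hsum
  unfold diagSq
  linear_combination hsum + hblock

/-- [cite: SuliMayers2003, §5.3 Thm 5.3]: consequently `L(B) = L(A) - 2 a_pq²`. -/
theorem offSq_rotConj (hA : A.IsSymm) (hpq : p ≠ q) (hcs : c ^ 2 + s ^ 2 = 1)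
    (h0 : rotConj A p q c s p q = 0) :
    offSq (rotConj A p q c s) = offSq A - 2 * A p q ^ 2 := by
  have h1 := sumSq_eq_diagSq_add_offSq A
  have h2 := sumSq_eq_diagSq_add_offSq (rotConj A p q c s)
  have h3 := sumSq_rotConj A hpq hcs
  have h4 := diagSq_rotConj hA hpq hcs h0
  linarith

omit [DecidableEq n] in
/-- `N = n(n-1)` is the number of off-diagonal positions [cite: SuliMayers2003, §5.3 Thm 5.3]. -/
theorem offCount_eq_card_offDiag :
    offCount n = ((Finset.univ : Finset n).offDiag.card : ℝ) := by
  rw [Finset.offDiag_card, Finset.card_univ, Nat.cast_sub (Nat.le_mul_self _), Nat.cast_mul,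
    offCount]
  ring

omit [DecidableEq n] in
/-- `N ≥ 2` as soon as there are two distinct indices
[cite: SuliMayers2003, §5.3 Thm 5.3 (5.15)]. -/
theorem two_le_offCount (hpq : p ≠ q) : 2 ≤ offCount n := by
  have h2 : 2 ≤ Fintype.card n :=
    Fintype.one_lt_card_iff_nontrivial.mpr ⟨⟨p, q, hpq⟩⟩
  have h2' : (2 : ℝ) ≤ Fintype.card n := by exact_mod_cast h2
  unfold offCount
  nlinarith

/-- [cite: SuliMayers2003, §5.3 Thm 5.3]: if `a_pq` is the off-diagonal element of largest absolute
value then `L(A) ≤ N a_pq²`, `N = n(n-1)`. -/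
theorem offSq_le_offCount_mul (A : Matrix n n ℝ)
    (hmax : ∀ i j, i ≠ j → |A i j| ≤ |A p q|) : offSq A ≤ offCount n * A p q ^ 2 := by
  have hK : ∀ i : n, ∑ j, (if i = j then (0 : ℝ) else A p q ^ 2) =
      ((Fintype.card n : ℝ) - 1) * A p q ^ 2 := by
    intro i
    have : ∀ j, (if i = j then (0 : ℝ) else A p q ^ 2) =
        A p q ^ 2 - if i = j then A p q ^ 2 else 0 := by
      intro j
      split_ifs <;> ring
    simp_rw [this]
    rw [Finset.sum_sub_distrib, Finset.sum_ite_eq]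
    simp [Finset.card_univ]
    ring
  calc offSq A = ∑ i, ∑ j, (if i = j then 0 else A i j ^ 2) := rfl
    _ ≤ ∑ i, ∑ j, (if i = j then (0 : ℝ) else A p q ^ 2) := by
        refine Finset.sum_le_sum fun i _ => Finset.sum_le_sum fun j _ => ?_
        split_ifs with hij
        · exact le_rfl
        · exact sq_le_sq.mpr (hmax i j hij)
    _ = ∑ _i : n, ((Fintype.card n : ℝ) - 1) * A p q ^ 2 := Finset.sum_congr rfl fun i _ => hK i
    _ = offCount n * A p q ^ 2 := by
        rw [Finset.sum_const, Finset.card_univ, nsmul_eq_mul, offCount]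
        ring

/-- (5.14) [cite: SuliMayers2003, §5.3 Thm 5.3 (5.14)]: annihilating the off-diagonal element of
largest absolute value gives `L(B) ≤ (1 - 2/N) L(A)`. -/
theorem offSq_rotConj_le (hA : A.IsSymm) (hpq : p ≠ q) (hcs : c ^ 2 + s ^ 2 = 1)
    (h0 : rotConj A p q c s p q = 0) (hmax : ∀ i j, i ≠ j → |A i j| ≤ |A p q|) :
    offSq (rotConj A p q c s) ≤ (1 - 2 / offCount n) * offSq A := by
  have hN : 0 < offCount n := by linarith [two_le_offCount hpq]
  have hle := offSq_le_offCount_mul A hmax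
  have h2 : 2 / offCount n * offSq A ≤ 2 * A p q ^ 2 := by
    rw [div_mul_eq_mul_div, div_le_iff₀ hN]
    nlinarith
  rw [offSq_rotConj hA hpq hcs h0]
  linarith

/-! ## Definition 5.3 and Theorem 5.3: the classical Jacobi iteration -/

/-- The off-diagonal element of largest absolute value exists (`n ≥ 2`)
[cite: SuliMayers2003, §5.3 Def 5.3]. -/
theorem exists_max_offDiag [Nontrivial n] (A : Matrix n n ℝ) :
    ∃ p q : n, p ≠ q ∧ ∀ i j, i ≠ j → |A i j| ≤ |A p q| := by
  obtain ⟨p₀, q₀, h₀⟩ := exists_pair_ne n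
  have hne : ((Finset.univ : Finset (n × n)).filter fun x => x.1 ≠ x.2).Nonempty :=
    ⟨(p₀, q₀), by simp [h₀]⟩
  obtain ⟨x, hmem, hmax⟩ := Finset.exists_max_image _ (fun x : n × n => |A x.1 x.2|) hne
  simp only [Finset.mem_filter, Finset.mem_univ, true_and] at hmem
  exact ⟨x.1, x.2, hmem, fun i j hij => hmax (i, j) (by simp [hij])⟩

/-- Definition 5.3 [cite: SuliMayers2003, §5.3 Def 5.3]: `B` is obtained from `A` by the basic step
of the classical Jacobi method — locate an off-diagonal element `a_pq` of largest absolute value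
and set `B = R^{(pq)}ᵀ A R^{(pq)}` with the rotation chosen so that `b_pq = 0`. -/
def IsJacobiStep (A B : Matrix n n ℝ) : Prop :=
  ∃ p q : n, ∃ c s : ℝ, p ≠ q ∧ (∀ i j, i ≠ j → |A i j| ≤ |A p q|) ∧
    c ^ 2 + s ^ 2 = 1 ∧ B = rotConj A p q c s ∧ B p q = 0

/-- The basic step is always possible for symmetric `A`, `n ≥ 2` (Theorem 5.2)
[cite: SuliMayers2003, §5.3 Def 5.3]. -/
theorem exists_isJacobiStep [Nontrivial n] (hA : A.IsSymm) : ∃ B, IsJacobiStep A B := by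
  obtain ⟨p, q, hpq, hmax⟩ := exists_max_offDiag A
  obtain ⟨c, s, hcs, -, -, h0⟩ := exists_cs_rotConj_pq_eq_zero hA hpq
  exact ⟨_, p, q, c, s, hpq, hmax, hcs, rfl, h0⟩

/-- [cite: SuliMayers2003, §5.3 Def 5.3]: the step maps `ℝ^{n×n}_sym` to `ℝ^{n×n}_sym`. -/
theorem IsJacobiStep.isSymm (h : IsJacobiStep A B) (hA : A.IsSymm) : B.IsSymm := by
  obtain ⟨p, q, c, s, -, -, -, rfl, -⟩ := h
  exact isSymm_rotConj hA p q c s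

/-- [cite: SuliMayers2003, §5.3 Thm 5.3]: `S(B) = S(A)` for a Jacobi step (Lemma 5.1). -/
theorem IsJacobiStep.sumSq_eq (h : IsJacobiStep A B) : sumSq B = sumSq A := by
  obtain ⟨p, q, c, s, hpq, -, hcs, rfl, -⟩ := h
  exact sumSq_rotConj A hpq hcs

/-- [cite: SuliMayers2003, §5.3 Thm 5.3]: for a Jacobi step annihilating `a_pq`,
`D(B) = D(A) + 2a_pq²` and `L(B) = L(A) - 2a_pq²`. -/
theorem IsJacobiStep.diagSq_offSq_eq (h : IsJacobiStep A B) (hA : A.IsSymm) :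
    ∃ p q : n, p ≠ q ∧ (∀ i j, i ≠ j → |A i j| ≤ |A p q|) ∧
      diagSq B = diagSq A + 2 * A p q ^ 2 ∧ offSq B = offSq A - 2 * A p q ^ 2 := by
  obtain ⟨p, q, c, s, hpq, hmax, hcs, rfl, h0⟩ := h
  exact ⟨p, q, hpq, hmax, diagSq_rotConj hA hpq hcs h0, offSq_rotConj hA hpq hcs h0⟩

/-- (5.14) for a Jacobi step [cite: SuliMayers2003, §5.3 Thm 5.3 (5.14)]:
`L(B) ≤ (1 - 2/N) L(A)`. -/
theorem IsJacobiStep.offSq_le (h : IsJacobiStep A B) (hA : A.IsSymm) :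
    offSq B ≤ (1 - 2 / offCount n) * offSq A := by
  obtain ⟨p, q, c, s, hpq, hmax, hcs, rfl, h0⟩ := h
  exact offSq_rotConj_le hA hpq hcs h0 hmax

/-- A Jacobi step needs two distinct indices, so `N ≥ 2` and `0 ≤ 1 - 2/N < 1`
[cite: SuliMayers2003, §5.3 Thm 5.3 (5.15)]. -/
theorem IsJacobiStep.factor_bounds (h : IsJacobiStep A B) :
    0 ≤ 1 - 2 / offCount n ∧ 1 - 2 / offCount n < 1 := by
  obtain ⟨p, q, c, s, hpq, -⟩ := h
  have hN := two_le_offCount (n := n) hpq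
  have hNpos : 0 < offCount n := by linarith
  constructor
  · rw [sub_nonneg, div_le_one hNpos]
    exact hN
  · have : 0 < 2 / offCount n := by positivity
    linarith

/-- Definition 5.3 [cite: SuliMayers2003, §5.3 Def 5.3]: starting from a symmetric `A^{(0)}` the
classical Jacobi method generates an infinite sequence `A^{(k+1)}` from `A^{(k)}` (`n ≥ 2`). -/
theorem exists_jacobiSeq [Nontrivial n] (hA : A.IsSymm) :
    ∃ M : ℕ → Matrix n n ℝ, M 0 = A ∧ ∀ k, IsJacobiStep (M k) (M (k + 1)) := by
  let g : {M : Matrix n n ℝ // M.IsSymm} → {M : Matrix n n ℝ // M.IsSymm} := fun M =>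
    ⟨Classical.choose (exists_isJacobiStep M.2),
      (Classical.choose_spec (exists_isJacobiStep M.2)).isSymm M.2⟩
  refine ⟨fun k => (g^[k] ⟨A, hA⟩).1, rfl, fun k => ?_⟩
  simp only [Function.iterate_succ_apply']
  exact Classical.choose_spec (exists_isJacobiStep (g^[k] ⟨A, hA⟩).2)

/-- Symmetry propagates along the Jacobi sequence [cite: SuliMayers2003, §5.3 Def 5.3]. -/
theorem isSymm_of_jacobiSeq {M : ℕ → Matrix n n ℝ} (h0 : (M 0).IsSymm)
    (hstep : ∀ k, IsJacobiStep (M k) (M (k + 1))) (k : ℕ) : (M k).IsSymm := by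
  induction k with
  | zero => exact h0
  | succ k ih => exact (hstep k).isSymm ih

/-- [cite: SuliMayers2003, §5.3 Thm 5.3]: `S(A^{(k)}) = S(A)` for all `k ≥ 0`. -/
theorem sumSq_jacobiSeq {M : ℕ → Matrix n n ℝ} (hstep : ∀ k, IsJacobiStep (M k) (M (k + 1)))
    (k : ℕ) : sumSq (M k) = sumSq (M 0) := by
  induction k with
  | zero => rfl
  | succ k ih => rw [(hstep k).sumSq_eq, ih]

/-- (5.15) [cite: SuliMayers2003, §5.3 Thm 5.3 (5.15)]:
`0 ≤ L(A^{(k)}) ≤ (1 - 2/N)^k L(A)`, `k = 0, 1, 2, …`. -/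
theorem offSq_jacobiSeq_le {M : ℕ → Matrix n n ℝ} (h0 : (M 0).IsSymm)
    (hstep : ∀ k, IsJacobiStep (M k) (M (k + 1))) (k : ℕ) :
    0 ≤ offSq (M k) ∧ offSq (M k) ≤ (1 - 2 / offCount n) ^ k * offSq (M 0) := by
  refine ⟨offSq_nonneg _, ?_⟩
  have hr := (hstep 0).factor_bounds.1
  induction k with
  | zero => simp
  | succ k ih =>
    calc offSq (M (k + 1)) ≤ (1 - 2 / offCount n) * offSq (M k) :=
          (hstep k).offSq_le (isSymm_of_jacobiSeq h0 hstep k)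
      _ ≤ (1 - 2 / offCount n) * ((1 - 2 / offCount n) ^ k * offSq (M 0)) :=
          mul_le_mul_of_nonneg_left ih hr
      _ = (1 - 2 / offCount n) ^ (k + 1) * offSq (M 0) := by ring

/-- (5.12) [cite: SuliMayers2003, §5.3 Thm 5.3 (5.12)]: in the classical Jacobi method
`lim_{k→∞} Σ_{i≠j} [(A^{(k)})_ij]² = 0`. -/
theorem tendsto_offSq_jacobiSeq {M : ℕ → Matrix n n ℝ} (h0 : (M 0).IsSymm)
    (hstep : ∀ k, IsJacobiStep (M k) (M (k + 1))) :
    Tendsto (fun k => offSq (M k)) atTop (𝓝 0) := by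
  have hr := (hstep 0).factor_bounds
  have hpow := tendsto_pow_atTop_nhds_zero_of_lt_one hr.1 hr.2
  refine squeeze_zero (fun k => offSq_nonneg _) (fun k => (offSq_jacobiSeq_le h0 hstep k).2) ?_
  simpa using hpow.mul_const (offSq (M 0))

/-- (5.12), entrywise [cite: SuliMayers2003, §5.3 Thm 5.3 (5.12)]: the off-diagonal entries of
`A^{(k)}` converge to `0` — the sequence approaches a diagonal matrix. -/
theorem tendsto_apply_jacobiSeq {M : ℕ → Matrix n n ℝ} (h0 : (M 0).IsSymm)
    (hstep : ∀ k, IsJacobiStep (M k) (M (k + 1))) (hij : i ≠ j) :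
    Tendsto (fun k => M k i j) atTop (𝓝 0) := by
  refine squeeze_zero_norm (fun k => ?_)
    (by simpa using (tendsto_offSq_jacobiSeq h0 hstep).sqrt)
  rw [Real.norm_eq_abs]
  exact Real.abs_le_sqrt (sq_le_offSq (M k) hij)

/-- (5.13) [cite: SuliMayers2003, §5.3 Thm 5.3 (5.13)]:
`lim_{k→∞} Σ_i [(A^{(k)})_ii]² = Trace(A²)` (since `Trace(A²) = S(A) = S(A^{(k)}) =
D(A^{(k)}) + L(A^{(k)})` for all `k` and `L(A^{(k)}) → 0`). -/
theorem tendsto_diagSq_jacobiSeq {M : ℕ → Matrix n n ℝ} (h0 : (M 0).IsSymm)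
    (hstep : ∀ k, IsJacobiStep (M k) (M (k + 1))) :
    Tendsto (fun k => diagSq (M k)) atTop (𝓝 (Matrix.trace (M 0 * M 0))) := by
  have hD : (fun k => diagSq (M k)) = fun k => sumSq (M 0) - offSq (M k) := by
    funext k
    have h1 := sumSq_eq_diagSq_add_offSq (M k)
    have h2 := sumSq_jacobiSeq hstep k
    linarith
  rw [hD, trace_mul_self_of_isSymm h0]
  simpa using (tendsto_const_nhds (x := sumSq (M 0))).sub (tendsto_offSq_jacobiSeq h0 hstep)

/-! ## Example 5.3 and the eigenvector remark -/

/-- The `5 × 5` matrix (5.16) of Example 5.3 [cite: SuliMayers2003, §5.3 Example 5.3 (5.16)]. -/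
def exampleMatrix : Matrix (Fin 5) (Fin 5) ℝ :=
  !![4, 1, 2, 1, 2; 1, 3, 0, -3, 4; 2, 0, 1, 2, 2; 1, -3, 2, 4, 1; 2, 4, 2, 1, 1]

/-- Table 5.1, row `k = 0` [cite: SuliMayers2003, §5.3 Example 5.3 Table 5.1]: for the matrix
(5.16), `D(A^{(0)}) = 43` and `L(A^{(0)}) = 88` (so `Trace(A²) = S(A) = 131`, the limit of
`D(A^{(k)})` in the last row of the table). -/
theorem exampleMatrix_diagSq_offSq :
    diagSq exampleMatrix = 43 ∧ offSq exampleMatrix = 88 ∧ sumSq exampleMatrix = 131 := by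
  refine ⟨?_, ?_, ?_⟩
  · simp [diagSq, exampleMatrix, Fin.sum_univ_five]
    norm_num
  · simp [offSq, exampleMatrix, Fin.sum_univ_five]
    norm_num
  · simp [sumSq, exampleMatrix, Fin.sum_univ_five]
    norm_num

/-- [cite: SuliMayers2003, §5.3 p. 144]: the accumulated product `M^{(k)} = R₁ ⋯ R_k` of
orthogonal matrices (the plane rotations used in the course of the iteration) is orthogonal. -/
theorem transpose_mul_self_of_prod {R : ℕ → Matrix n n ℝ} (hR : ∀ j, (R j)ᵀ * R j = 1) :
    ∀ k, ((List.range k).map R).prodᵀ * ((List.range k).map R).prod = 1 := by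
  intro k
  induction k with
  | zero => simp
  | succ k ih =>
    rw [List.range_succ, List.map_append, List.map_singleton, List.prod_append,
      List.prod_singleton, Matrix.transpose_mul]
    calc (R k)ᵀ * ((List.range k).map R).prodᵀ * (((List.range k).map R).prod * R k)
          = (R k)ᵀ * (((List.range k).map R).prodᵀ * ((List.range k).map R).prod) * R k := by
            simp only [Matrix.mul_assoc]
      _ = 1 := by rw [ih, Matrix.mul_one, hR k]

/-- [cite: SuliMayers2003, §5.3 p. 144]: if `M` is orthogonal and `MᵀAM = D` is diagonal then the
columns of `M` are eigenvectors of `A` for the diagonal entries of `D`: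
`A m_i = d_i m_i` where `m_i` is the `i`-th column of `M`. -/
theorem mulVec_col_of_diagonalised (A M : Matrix n n ℝ) (d : n → ℝ) (hM : M * Mᵀ = 1)
    (hD : Mᵀ * A * M = Matrix.diagonal d) (i : n) :
    A.mulVec (fun k => M k i) = d i • fun k => M k i := by
  have hAM : A * M = M * Matrix.diagonal d := by
    rw [← hD, ← Matrix.mul_assoc, ← Matrix.mul_assoc, hM, Matrix.one_mul]
  funext k
  have h := congrFun (congrFun hAM k) i
  rw [Matrix.mul_apply, Matrix.mul_diagonal] at h
  simp only [Matrix.mulVec, dotProduct, Pi.smul_apply, smul_eq_mul]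
  rw [h, mul_comm]

end Literature.Analysis.Matrix.JacobiRotationMethod

end
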